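import Summits.BirchSwinnertonDyer.Rank1Residual.X11b.BDPRouteHalvesClass
import Summits.BirchSwinnertonDyer.BirchSwinnertonDyer.Theorems.ToricSheddingUBPotentiallyGoodStubTwistAdmissible
import Literature.NumberTheory.EllipticCurves.Wuthrich2014.ShaBoundProofs
import Literature.NumberTheory.EllipticCurves.CongruenceVisibilityLocalFactors
import HarnessLib

/-!
# Class X11b, route "BDP + converse-theorem engine + Kolyvagin" WITHOUT the (ram) prime: the main-conjecture half on X11b ∧ surj(p) from STEP L — Wuthrich 2014 Prop. 21 feeds the twist (cell `b2b-bsdres`, sub-cell `multr1-p2`, gen 6)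

HONEST FRAMING (cell `b2b-bsdres`, run/shared/lean/b2b/bsd-rank1-residual/, verbatim in every
file): the goal of the cell is to DELETE the COMBINATION-SHAPED residual classes of the
Birch–Swinnerton-Dyer formula for ALL analytic-rank `≤ 1` elliptic curves over `ℚ` — "full BSD
formula for every rank `≤ 1` curve in class `C`" assembled STRICTLY from published theorems — so
that the rank-`≤ 1` remainder becomes exactly the CONSTRUCTION-SHAPED classes, which are TYPED
(missing-input `Prop`s), NOT attempted. This is not "finishing BSD". Sub-cell `multr1-p2` is a
RESEARCH ROUTE on class X11b (`ClassX11b W p := r_an = 1 ∧ p ≠ 2 ∧ mult(p) ∧ irr(p)`,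
`Partition/Rows.lean`); no claim beyond the stated class and loci; X11b's label does not change;
nothing is booked.

THEOREMS ONLY (no definition, no named fact). Gens 1–5 of the route (`X11b/BDPRoute*.lean`) carry the
hypothesis `Ram W p` ("a multiplicative prime `q ≠ p` with `E[p]` ramified at `q`") in BOTH halves,
because the rank-`0` `p`-part for the Heegner twist `E^{d_K}` was taken from Skinner, Pacific J.
Math. 283 (2016) Thm. C (an EQUALITY, printed under (ram)). But the MAIN-CONJECTURE half of
`BSD(E,p)` (`Typed.MissingLowerBoundAt W p`: `ord_p #Ш(E)_an ≤ ord_p #Ш(E)`) consumes only the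
`≤`-half of the twist's rank-`0` `p`-part (`X11b/BDPRouteHalves.lean`,
`missingLowerBoundAt_of_indexLowerBoundAt`, hypothesis `htw`), and THAT half is in print WITHOUT
(ram): Wuthrich, Doc. Math. 19 (2014) Prop. 21 (p. 400), verbatim — "Let `E` be an elliptic curve
over `ℚ` such that `L(E,1) ≠ 0`. … Then `#Ш(E/ℚ)` divides `C · (L(E,1)/Ω⁺_E) · (#E(ℚ))² / ∏_v c_v`
where `C` is a rational number only divisible by `2`, primes of additive reduction or primes for
which the Galois representation on `E[p]` is neither surjective nor contained in a Borel subgroup"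
(tree NAMED FACT `Wuthrich2014.sha_dvd_analyticSha`, PUBLISHED; its consumer
`Wuthrich2014.padicValNat_shaOrder_le_of_sha_dvd`). At the twist: `E^{d_K}` is multiplicative at `p`
(every `ℓ ∣ N` splits in `K`: `hasMultiplicativeReductionAtPrime_twist_of_heegner'`), hence not
additive, and `ρ̄_{E^{d_K},p} ≅ ρ̄_{E,p} ⊗ χ_{d_K}` is onto `GL₂(𝔽_p)` when `ρ̄_{E,p}` is (tree theorem
`twistAdmissible_hasSurjectiveModNGaloisRep_smul_quadraticTwist`, Serre 1972 §4: the two images agree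
up to the central `−1 = J²`). So:

* §1 `twist_le_half_of_wuthrich` — the `≤`-half shape `htw` for a rank-`0` curve multiplicative at
  `p` with `ρ̄` onto, from Wuthrich's Prop. 21; `not_ram_twist_of_heegner` — transport (c) in the
  reverse direction (`¬ Ram W p → ¬ Ram Wd p` for the Heegner twist; `j`-invariant + `ℚ_ℓ`-isomorphism).
* §2 **`missingLowerBoundAt_of_indexLowerBoundAt_of_surj`** (data level) and
  **`missingLowerBoundAt_of_classX11b_of_surj`** (class level): for EVERY `(E,p)` in X11b with
  `p ≥ 5` and `ρ̄_{E,p}` onto (in particular every (ram) pair, `surj_of_irr_of_ram`, but also the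
  `¬(ram)` pairs), STEP L (the route's typed input `IndexLowerBoundAt`, OPEN at `p ∥ N`) at a
  Manin-good Heegner datum ⇒ `Typed.MissingLowerBoundAt W p`. Published inputs: Gross–Zagier,
  Kolyvagin (qualitative), Wuthrich 2014 Prop. 21, GZK over `ℚ`, modularity (×2), Friedberg–Hoffstein,
  Mazur 1978 Cor. 4.1, the Néron mapping property. The route's typed input therefore governs the
  main-conjecture half on the WHOLE surjective part of X11b at `p ≥ 5`, (ram) or not.
* the `¬(ram)` atom's Euler-system half (⇐ the main-conjecture half on the rank-`0` sister class
  X11a, via additive-p1's Kolyvagin tool and the reverse transport `not_ram_twist_of_heegner`) and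
  its `BSD(E,p)` end form are in the companion file `X11b/BDPRouteNoRam.lean`.

READING (numbers, not adjectives; in-window CORE-open counts from the hyp seat's SUBCELL-LEDGER,
`N < 2·10⁴ ‖ N < 10⁴`, class X11b, `p ≥ 5`): the `¬(ram)` atoms `X11b:noram.*` hold 11 ‖ 2 pairs
(all with `ρ̄` onto per the x11c/hyp census), the (ram) atoms 130 ‖ 36. Before this file the route
said nothing on `¬(ram)`; now its typed input STEP L delivers the main-conjecture half there too.
Per pair these 11 ‖ 2 rows are the x11c seat's (`MultiplicativeDivisibility*.lean`, Kato's
divisibility A32 under surj). CONDITIONAL results; X11b stays CONSTRUCTION-SHAPED.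

References: [Wuthrich2014] Prop. 21 (p. 400); [JetchevSkinnerWan2017] §7.4.1–7.4.2 (pp. 30–31 of
arXiv:1512.06894); [Serre1972] §4; [SilvermanAEC2009] X.5 Cor. 5.4, VII.5 Prop. 5.1;
[McCallumLMS1991] §1; [Mazur1978] Cor. 4.1; [Miller2011LMS] Def. 1.1.
-/

noncomputable section

open scoped Classical

open WeierstrassCurve NumberField Literature.NumberTheory.EllipticCurves
  Literature.NumberTheory.EllipticCurves.ModularForms
  Literature.NumberTheory.EllipticCurves.Rank1Residual
  Literature.NumberTheory.EllipticCurves.Rank1Residual.Typed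
  Literature.NumberTheory.EllipticCurves.Wuthrich2014
  Summit.BirchSwinnertonDyer.BirchSwinnertonDyer.Theorems

namespace Summit.BirchSwinnertonDyer.Rank1Residual.X11b

/-! ### §1 The twist's `≤`-half from Wuthrich 2014 Prop. 21; transports for surj and `¬`(ram) -/

/-- **The `≤`-half of the rank-`0` `p`-part at a multiplicative prime with surjective `ρ̄`, from
Wuthrich 2014 Prop. 21.** For `Wd/ℚ` globally minimal with `L(E^D,1) ≠ 0`, `p` odd, `Wd`
multiplicative at `p` (hence not additive) and `ρ̄_{E^D,p}` onto: `L(E^D,1)/Ω = q ∈ ℚ` with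
`ord_p #Ш(E^D) + ord_p ∏_ℓ c_ℓ(E^D) − 2·ord_p #E^D(ℚ)_tors ≤ ord_p q` — the shape `htw` of
`missingLowerBoundAt_of_indexLowerBoundAt` (Jetchev–Skinner–Wan Thm. 7.2.1 (i)). `E^D(ℚ)` is finite
of order `#E^D(ℚ)_tors` and `Ш(E^D)` is finite by Gross–Zagier–Kolyvagin (`hGZK`); modularity `hmod`
turns `L(E^D,1) ≠ 0` into `r_an = 0`. [cite: Wuthrich2014, Prop. 21 (p. 400)] -/
theorem twist_le_half_of_wuthrich (hWu : sha_dvd_analyticSha)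
    (hGZK : rank_eq_analyticRank_of_analyticRank_le_one) (hmod : hasEntireLFunction_rat)
    (Wd : WeierstrassCurve ℚ) [Wd.IsElliptic] [Wd.IsGloballyMinimal] (p : ℕ) [Fact p.Prime]
    (hp2 : p ≠ 2) (hL1 : Wd.entireLFunction 1 ≠ 0) (hmult : Wd.HasMultiplicativeReductionAtPrime p)
    (hsurj : Wd.HasSurjectiveModNGaloisRep p) :
    ∃ q : ℚ, Wd.entireLFunction 1 / (Wd.realPeriodRat : ℂ) = (q : ℂ) ∧
      (padicValNat p Wd.shaOrder : ℤ) + padicValNat p Wd.tamagawaProduct -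
        2 * padicValNat p Wd.torsionOrder ≤ padicValRat p q := by
  have hp : p.Prime := Fact.out
  have hrd : Wd.analyticRank = 0 := (Wd.analyticRank_eq_zero_iff_holds (hmod Wd)).2 hL1
  obtain ⟨hrank, hfin⟩ := hGZK Wd (by omega)
  have hmw0 : Wd.mordellWeilRank = 0 := by omega
  haveI hE : Finite Wd.toAffine.Point := Wd.finite_point_of_rank_zero hmw0
  obtain ⟨q, hq, hq0, hle⟩ := padicValNat_shaOrder_le_of_sha_dvd hWu Wd p hp2 hL1 hE hfin
    (WeierstrassCurve.HasMultiplicativeReduction.not_hasAdditiveReduction _ hmult) (Or.inr hsurj)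
  refine ⟨q, hq, ?_⟩
  have ht0 : (Wd.torsionOrder : ℚ) ≠ 0 := by exact_mod_cast (Wd.torsionOrder_pos_holds).ne'
  have hc0 : (Wd.tamagawaProduct : ℚ) ≠ 0 := by exact_mod_cast (Wd.tamagawaProduct_pos').ne'
  rw [Wd.natCard_point_eq_torsionOrder] at hle
  have h2 : padicValRat p (q * (Wd.torsionOrder : ℚ) ^ 2 / (Wd.tamagawaProduct : ℚ)) =
      padicValRat p q + 2 * (padicValNat p Wd.torsionOrder : ℤ) -
        (padicValNat p Wd.tamagawaProduct : ℤ) := by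
    rw [padicValRat.div (mul_ne_zero hq0 (pow_ne_zero 2 ht0)) hc0,
      padicValRat.mul hq0 (pow_ne_zero 2 ht0), padicValRat.pow (Wd.torsionOrder : ℚ),
      padicValRat.of_nat, padicValRat.of_nat]
    push_cast
    ring
  rw [h2] at hle
  linarith

/-- **`ρ̄_{E^{d_K},p}` onto from `ρ̄_{E,p}` onto**, for any model `Cd • W^{(d_K)}` of the twist
(`E^{(d)}[p] ≅ E[p] ⊗ χ_d`; the two images agree up to the central `−1`, a square in `Aut(E[p])`;
tree theorem `twistAdmissible_hasSurjectiveModNGaloisRep_smul_quadraticTwist`).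
[cite: SilvermanAEC2009, X.5 Cor. 5.4] [cite: Serre1972, §4] -/
theorem surj_twist_model (W : WeierstrassCurve ℚ) [W.IsElliptic] (p : ℕ) [Fact p.Prime]
    (K : Type) [Field K] [NumberField K] (hsurj : Surj W p) {Wd : WeierstrassCurve ℚ}
    (Cd : VariableChange ℚ) (hWd : Cd • W.quadraticTwist (NumberField.discr K : ℚ) = Wd) :
    Surj Wd p := by
  have hD0 : (NumberField.discr K : ℚ) ≠ 0 := by exact_mod_cast NumberField.discr_ne_zero K
  rw [← hWd]
  exact twistAdmissible_hasSurjectiveModNGaloisRep_smul_quadraticTwist W hD0 Cd p hsurj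

/-- **Transport (c), reverse direction: a (ram) prime of the Heegner twist is a (ram) prime of `E`.**
`W`, `Wd = Cd • W^{(d_K)}` globally minimal, `K` imaginary quadratic with every prime of the conductor
`N` of `W` split. If `ℓ ≠ p` is multiplicative for `Wd` with `p ∤ v_ℓ(Δ_min(Wd))`, then `ℓ ∣ N`
(otherwise `W` is good at `ℓ`, `j(Wd) = j(W)` is `ℓ`-integral and `Wd` is not multiplicative at `ℓ`:
`not_hasMultiplicativeReductionAtPrime_of_j_eq`), so `d_K ∈ ℚ_ℓ^{×2}`
(`isSquare_discr_padic_of_heegner`), `W` is multiplicative at `ℓ`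
(`hasMultiplicativeReductionAtPrime_quadraticTwist_iff`, `…_smul_iff`) and
`v_ℓ(Δ_min(W)) = v_ℓ(Δ_min(Wd))` (`padicValInt_minimalDiscriminantInt_twist_eq`). Hence
`Ram Wd p → Ram W p`, i.e. `¬ Ram W p → ¬ Ram Wd p`. [cite: SilvermanAEC2009, VII.5 Prop. 5.1(b), VII.1 Prop. 1.3(b) and X.5 Cor. 5.4] -/
theorem not_ram_twist_of_heegner (W : WeierstrassCurve ℚ) [W.IsElliptic] [W.IsGloballyMinimal]
    (p : ℕ) [Fact p.Prime] (K : Type) [Field K] [NumberField K] (hK : IsImaginaryQuadratic K)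
    (hH : SatisfiesHeegnerHypothesis (W.conductorNorm ℤ) K) (hnram : ¬ Ram W p)
    {Wd : WeierstrassCurve ℚ} [Wd.IsElliptic] [Wd.IsGloballyMinimal] (Cd : VariableChange ℚ)
    (hWd : Cd • W.quadraticTwist (NumberField.discr K : ℚ) = Wd) : ¬ Ram Wd p := by
  rintro ⟨ℓ, hℓ, hℓp, hmultd, hv⟩
  have hD0 : (NumberField.discr K : ℚ) ≠ 0 := by exact_mod_cast NumberField.discr_ne_zero K
  haveI : (W.quadraticTwist (NumberField.discr K : ℚ)).IsElliptic := W.isElliptic_quadraticTwist hD0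
  have hj : Wd.j = W.j := by
    have h1 : Wd.j = (Cd • W.quadraticTwist (NumberField.discr K : ℚ)).j := by subst hWd; rfl
    rw [h1, variableChange_j]
    exact W.j_quadraticTwist hD0
  have hℓN : ℓ ∣ W.conductorNorm ℤ := by
    by_contra h
    have hgood : W.HasGoodReductionAtPrime ℓ := by
      by_contra h'
      exact h ((W.dvd_conductorNorm_iff_not_hasGoodReductionAtPrime ℓ).mpr h')
    exact not_hasMultiplicativeReductionAtPrime_of_j_eq hj ℓ hgood hmultd
  have hsq := isSquare_discr_padic_of_heegner K hK hH ℓ hℓN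
  refine hnram ⟨ℓ, hℓ, hℓp, ?_, ?_⟩
  · have h := hmultd
    rw [← hWd, hasMultiplicativeReductionAtPrime_smul_iff,
      hasMultiplicativeReductionAtPrime_quadraticTwist_iff W hD0 hsq] at h
    exact h
  · rw [← padicValInt_minimalDiscriminantInt_twist_eq W ℓ hD0 hsq Cd hWd]
    exact hv

/-! ### §2 The main-conjecture half on X11b ∧ surj(p), `p ≥ 5`, from STEP L — no (ram) prime -/

/-- **STEP L ⇒ the main-conjecture half, at fixed Heegner data, for `ρ̄_{E,p}` onto (no (ram)
prime).** Data: `W/ℚ` globally minimal of conductor `N`, `ord_{s=1} L(E,s) = 1`, `p ≥ 5`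
multiplicative for `E` with `ρ̄_{E,p}` onto; `K` imaginary quadratic with the Heegner hypothesis for
`N`, `p ∤ #𝓞_K^×`, `L(E^{d_K},1) ≠ 0`; `P` the Heegner point of a datum `Dt` with `p ∤ c`;
`Wd = Cd • W^{(d_K)}` a globally minimal model of the twist. PUBLISHED binders: `hGZ`, `hKo`, `hWu`
(Wuthrich 2014 Prop. 21 — the twist's `≤`-half: `Wd` is multiplicative at `p` and `ρ̄_{E^D,p}` is
onto, transported from `W`), `hGZK`, `hmod`; transports (d) `ord_p ∏c(Wd) = ord_p ∏c(W)` (`p ≥ 5`)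
and (e) `ord_p u(Cd) = 0` are tree theorems. CONCLUSION: `IndexLowerBoundAt W p K P →
Typed.MissingLowerBoundAt W p`. Compare `halves_of_heegnerData` (gen 3: the same with `Ram W p` and
Skinner 2016 Thm. C). CONDITIONAL on STEP L. [cite: Wuthrich2014, Prop. 21 (p. 400)]
[cite: JetchevSkinnerWan2017, §7.4.1 (pp. 30–31)] [cite: Miller2011LMS, Def. 1.1] -/
theorem missingLowerBoundAt_of_indexLowerBoundAt_of_surj
    (W : WeierstrassCurve ℚ) [W.IsElliptic] [W.IsGloballyMinimal] (p : ℕ) [Fact p.Prime]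
    [NeZero (W.conductorNorm ℤ)] (K : Type) [Field K] [NumberField K]
    (Dt : ModularParametrizationData W (W.conductorNorm ℤ))
    (H : HeegnerDatum (W.conductorNorm ℤ) (NumberField.discr K)) (ι : K →+* ℂ)
    (P : (W.baseChange K).toAffine.Point)
    -- the published inputs (named facts of the tree)
    (hGZ : gross_zagier (W.conductorNorm ℤ) W K) (hKo : kolyvagin (W.conductorNorm ℤ) W K)
    (hWu : sha_dvd_analyticSha)
    (hGZK : rank_eq_analyticRank_of_analyticRank_le_one) (hmod : hasEntireLFunction_rat)
    -- the pair
    (hr : W.analyticRank = 1) (hp5 : 5 ≤ p) (hmult : Mult W p) (hsurj : Surj W p)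
    -- the Heegner data
    (hK : IsImaginaryQuadratic K) (hHN : SatisfiesHeegnerHypothesis (W.conductorNorm ℤ) K)
    (hP : WeierstrassCurve.Affine.Point.map ι.toRatAlgHom P = heegnerPointComplex Dt H)
    (hc : ¬ (p : ℤ) ∣ Dt.c) (hμ : ¬ p ∣ Units.torsionOrder K)
    (hLt : (W.quadraticTwist (NumberField.discr K : ℚ)).entireLFunction 1 ≠ 0)
    (Wd : WeierstrassCurve ℚ) [Wd.IsElliptic] [Wd.IsGloballyMinimal] (Cd : VariableChange ℚ)
    (hWd : Cd • W.quadraticTwist (NumberField.discr K : ℚ) = Wd)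
    -- STEP L (the typed input of the route)
    (hL : IndexLowerBoundAt W p K P) :
    Typed.MissingLowerBoundAt W p := by
  have hp2 : p ≠ 2 := by omega
  have hD0 : (NumberField.discr K : ℚ) ≠ 0 := by exact_mod_cast NumberField.discr_ne_zero K
  haveI hEt : (W.quadraticTwist (NumberField.discr K : ℚ)).IsElliptic :=
    W.isElliptic_quadraticTwist hD0
  -- transports (a), (d), (e) and surjectivity to the minimal twist model
  have hmultd : Wd.HasMultiplicativeReductionAtPrime p :=
    hasMultiplicativeReductionAtPrime_twist_of_heegner' W p K hK hHN hmult Cd hWd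
  have hsurjd : Surj Wd p := surj_twist_model W p K hsurj Cd hWd
  have htam : padicValNat p Wd.tamagawaProduct = padicValNat p W.tamagawaProduct :=
    padicValNat_tamagawaProduct_twist_of_heegner W p hp5 K hK hHN Cd hWd
  have hu : padicValRat p (Cd.u : ℚ) = 0 :=
    padicValRat_u_eq_zero_of_twist_minimal W p K hK hHN hmult Cd hWd
  -- the twist: `L(E^D,1) ≠ 0` and Wuthrich's `≤`-half
  have hLt' : (W.quadraticTwist (NumberField.discr K : ℚ)).entireLFunction = Wd.entireLFunction := by
    rw [← hWd, entireLFunction_smul]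
  have hLd1 : Wd.entireLFunction 1 ≠ 0 := by rw [← hLt']; exact hLt
  have htw := twist_le_half_of_wuthrich hWu hGZK hmod Wd p hp2 hLd1 hmultd hsurjd
  exact missingLowerBoundAt_of_indexLowerBoundAt W p (W.conductorNorm ℤ) K Dt H ι P hGZ hKo hGZK
    hmod hK hHN hP hp2 hc hμ hr hLt Wd Cd hWd hu htam htw (fun _ ↦ hL)

/-- **The main-conjecture half of `BSD(E,p)` from STEP L on X11b ∧ `p ≥ 5` ∧ surj(p) — NO (ram)
prime, NO Tamagawa condition.** For every `(E,p)` in X11b (`r_an = 1`, `p` odd multiplicative, `E[p]`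
irreducible) with `p ≥ 5` and `ρ̄_{E,p}` onto `GL₂(𝔽_p)`: STEP L (`hL`, the route's typed input
`IndexLowerBoundAt`, OPEN at `p ∥ N`, at every Manin-good Heegner datum of such a pair) and the
PUBLISHED named facts `hGZ`, `hKo`, `hWu` (Wuthrich 2014 Prop. 21, for the twist), `hGZK`, `hmod`,
`hnf`, `hFH` (Friedberg–Hoffstein: a field `K` with every `ℓ ∣ N` split, `|d_K| > 4`, `L(E^{d_K},1) ≠ 0`),
`hMaz`, `hNS` (the Manin-unit datum: `exists_maninDatum`) imply `ord_p #Ш(E)_an ≤ ord_p #Ш(E)`.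
This extends gen 3's `missingLowerBoundAt_of_classX11b_of_ram` from (ram) to surj(p) ((ram) ⇒ surj:
`surj_of_irr_of_ram`), i.e. to the `¬(ram)` atom of X11b. CONDITIONAL on STEP L; nothing booked;
X11b stays CONSTRUCTION-SHAPED. [cite: Wuthrich2014, Prop. 21 (p. 400)]
[cite: JetchevSkinnerWan2017, §7.4.1 (pp. 30–31)] [cite: Mazur1978, Cor. 4.1] [cite: Miller2011LMS, Def. 1.1] -/
theorem missingLowerBoundAt_of_classX11b_of_surj
    -- published inputs (named facts of the tree)
    (hGZ : ∀ (N : ℕ) [NeZero N] (W : WeierstrassCurve ℚ) (K : Type) [Field K] [NumberField K],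
      gross_zagier N W K)
    (hKo : ∀ (N : ℕ) [NeZero N] (W : WeierstrassCurve ℚ) (K : Type) [Field K] [NumberField K],
      kolyvagin N W K)
    (hWu : sha_dvd_analyticSha)
    (hGZK : rank_eq_analyticRank_of_analyticRank_le_one) (hmod : hasEntireLFunction_rat)
    (hnf : exists_isNewformOf)
    (hFH : friedbergHoffstein_exists_heegnerField_split_twist_ne_zero)
    (hMaz : mazur_not_dvd_maninConstant_of_odd) (hNS : integral_neronScaling_of_isGloballyMinimal)
    -- the typed input of the route (STEP L), at every Heegner datum with Manin constant prime to `p`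
    (hL : ∀ (W : WeierstrassCurve ℚ) [W.IsElliptic] [W.IsGloballyMinimal] (p : ℕ) [Fact p.Prime]
      (N : ℕ) [NeZero N] (K : Type) [Field K] [NumberField K]
      (Dt : ModularParametrizationData W N) (H : HeegnerDatum N (NumberField.discr K)) (ι : K →+* ℂ)
      (P : (W.baseChange K).toAffine.Point),
      ClassX11b W p → 5 ≤ p → Surj W p → W.conductorNorm ℤ = N → IsImaginaryQuadratic K →
      SatisfiesHeegnerHypothesis N K →
      WeierstrassCurve.Affine.Point.map ι.toRatAlgHom P = heegnerPointComplex Dt H →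
      ¬ (p : ℤ) ∣ Dt.c → IndexLowerBoundAt W p K P) :
    ∀ (W : WeierstrassCurve ℚ) [W.IsElliptic] [W.IsGloballyMinimal] (p : ℕ) [Fact p.Prime],
      ClassX11b W p → 5 ≤ p → Surj W p → Typed.MissingLowerBoundAt W p := by
  intro W _ _ p _ hX hp5 hsurj
  have hp : p.Prime := Fact.out
  have hX' := hX
  obtain ⟨hr, -, hmult, hirr⟩ := hX
  haveI : NeZero (W.conductorNorm ℤ) := ⟨(W.conductorNorm_pos_holds).ne'⟩
  -- the sign of the functional equation is `−1` (modularity, `r_an = 1`)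
  have hw : W.rootNumber = -1 := by
    rw [WeierstrassCurve.rootNumber_eq_neg_one_pow_analyticRank_of_exists_isNewformOf hnf W, hr]
    norm_num
  -- the auxiliary field (Friedberg–Hoffstein): every `ℓ ∣ N` split, `|d_K| > 4`, `L(E^{d_K},1) ≠ 0`
  obtain ⟨K, _, _, hK, hdisc, hHN, -, hLt⟩ := hFH W hw p hp 4
  -- `w_K = 2`, prime to `p ≥ 5`
  have hμ : ¬ p ∣ Units.torsionOrder K := by
    haveI : IsTotallyComplex K := hK.2
    have hneg : NumberField.discr K < 0 := discr_neg_of_finrank_eq_two K hK.1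
    have habs : ((NumberField.discr K).natAbs : ℤ) = -NumberField.discr K :=
      Int.ofNat_natAbs_of_nonpos hneg.le
    have h4 : NumberField.discr K < -4 := by
      have : (4 : ℤ) < ((NumberField.discr K).natAbs : ℤ) := by exact_mod_cast hdisc
      omega
    rw [Literature.NumberTheory.DiophantineGeometry.torsionOrder_eq_two_of_discr_lt hK.1 h4]
    intro h2
    have := Nat.le_of_dvd two_pos h2
    omega
  -- the Heegner datum with `p ∤ c` (modularity, Mazur 1978 Cor. 4.1, Néron mapping property)
  obtain ⟨Dt, H, ι, P, hP, hc⟩ :=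
    exists_maninDatum hnf hMaz hNS W p (W.conductorNorm ℤ) K rfl hp5 hmult hirr hK hHN
  -- a globally minimal model of the twist
  have hD0 : (NumberField.discr K : ℚ) ≠ 0 := by exact_mod_cast NumberField.discr_ne_zero K
  haveI hEt : (W.quadraticTwist (NumberField.discr K : ℚ)).IsElliptic :=
    W.isElliptic_quadraticTwist hD0
  obtain ⟨Cd, hCd⟩ := hasGlobalMinimalModel_rat_holds (W.quadraticTwist (NumberField.discr K : ℚ))
  haveI : (Cd • W.quadraticTwist (NumberField.discr K : ℚ)).IsGloballyMinimal := hCd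
  have hWd : Cd • W.quadraticTwist (NumberField.discr K : ℚ) =
      Cd • W.quadraticTwist (NumberField.discr K : ℚ) := rfl
  exact missingLowerBoundAt_of_indexLowerBoundAt_of_surj W p K Dt H ι P (hGZ _ W K) (hKo _ W K)
    hWu hGZK hmod hr hp5 hmult hsurj hK hHN hP hc hμ hLt
    (Cd • W.quadraticTwist (NumberField.discr K : ℚ)) Cd hWd
    (hL W p _ K Dt H ι P hX' hp5 hsurj rfl hK hHN hP hc)

end Summit.BirchSwinnertonDyer.Rank1Residual.X11b

end
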